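import Literature.NumberTheory.GelbartRogawski1991.LocalUnitaryUndoublingSplitMixedModel
import Literature.NumberTheory.GelbartRogawski1991.LocalDoubledUnitarySplitPlaceSymmetric
import Literature.NumberTheory.GelbartRogawski1991.LocalDoubledUnitarySplittingDataQuadExt
import HarnessLib

/-!
# The `χ`-package at a split place, read at EITHER place above `v`: the mixed model with character `χ_w⁻¹ ∘ det`
# ([Kudla1994, Thm 3.1]; [HarrisKudlaSweet1996, §1 (1.15)–(1.16)]; [MoeglinVignerasWaldspurger1987, Chap. 3 III.1])

Topic `NumberTheory/GelbartRogawski1991`; namespace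
`Literature.NumberTheory.GelbartRogawski1991.UnitaryDualPair.LocalSplitting.QuadExt`. KERNEL ONLY: theorems; no
definition, no named fact, no `sorry`.

The local datum of a global splitting character `χ` of `E/F` (`localSplittingDatumQuadExt … χ hχ`; for a CM field it
IS `localSplittingDatumCM`, `localSplittingDatumCM_eq`) at a place `v` of `F` split in `E` is the split datum
`localSplittingDatumSplit … w₀ … (fun w ↦ χ_w⁻¹)` at a CHOSEN place `w₀ = h.choose` above `v`. This file removes the
choice: for ANY `w ∣ v` with `c • w ≠ w`

* §1 `localSplitting_localSplittingDatumQuadExt_eq` — **the package's splitting IS the `w`-datum's splitting**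
  (`localSplitting_localSplittingDatumSplit_eq`: Kudla's split-place splitting does not depend on the chosen place;
  the split-pair / trivial-near-`1` hypotheses at both places are the tree's `isSplitPair_localComponent_inv`,
  `isTrivialNearOne_localComponent_inv`);
* §2 `exists_mixedModel_undoubleLoc_localSplittingDatumQuadExt` — **the undoubled package at `w` is the mixed model
  with character `χ_w ∘ det ∘ pr_w`**: an `L²`-isometric `Γ` with
  `ω_{s_v}(κ_a) Φ = χ_w(det ι_w(a)) • Γ⁻¹ (leviOpPi (x ↦ a⁻ᵀ x) (Γ Φ))` for `s_v := undoubleLoc (…QuadExt…).localSplitting`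
  (`exists_mixedModel_undoubleLoc_localSplittingDatumSplit` with `χv w := χ_w⁻¹`, so the inverse disappears), and the
  `(η, νK)` of the tree's `splitPlace_chiCoinv_iso_parabolicIndGL_explicit` with NO inverse:
  `η := χ_w ∘ det ∘ localPiSplitEquiv`, `νK := χ_w ∘ ι_w`, `ν := χ_w` (`chi_det_symm_map`).

So the split-place Satake parameter `ν` of the `χ`-package's oscillator representation at `w` is `ν = χ_w` for BOTH
places `w ∣ v` (with `χ = μᶜ`: `ν = (μᶜ)_w = μ_w⁻¹`, `Automorphic/ConjugateSelfDualLocalValues`). The degree-one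
isomorphism `ι_w : F_v ≃+* E_w` used by consumers is the tree's `adicCompletionEquivOfDegreeOne` /
`RingEquiv.ofBijective (toPlace v w) ⟨_, toPlace_surjective …⟩` (as in `SplitPlaceMixedModel.exists_mixedModel`).
Written for the d6 line of the cell `hodgecm-mathlib` (card S4 «S4-pkg2»); nothing here is a claim of [Liu2021].

## References

* S. S. Kudla, Israel J. Math. 87 (1994) 361–401, §3, Thm 3.1 [Kudla1994].
* M. Harris, S. S. Kudla, W. J. Sweet, J. Amer. Math. Soc. 9 (1996), §1 (1.15)–(1.16) [HarrisKudlaSweet1996].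
* C. Mœglin, M.-F. Vignéras, J.-L. Waldspurger, LNM 1291 (1987), Chap. 2 II.1, Chap. 3 III.1
  [MoeglinVignerasWaldspurger1987].
-/

set_option autoImplicit false

noncomputable section

open NumberField IsDedekindDomain MeasureTheory Matrix
open Literature.RepresentationTheory.HeisenbergGroup Literature.RepresentationTheory.HeisenbergGroup.SymplecticMatrix
open Literature.NumberTheory.Automorphic Literature.NumberTheory.Automorphic.UnitaryGroup Literature.NumberTheory.Weil1964
open Literature.NumberTheory.GaloisRepresentations Literature.RepresentationTheory.HarrisKudlaSweet1996

namespace Literature.NumberTheory.GelbartRogawski1991.UnitaryDualPair.LocalSplitting.QuadExt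

variable (F : Type) [Field F] [NumberField F] (E : Type) [Field E] [NumberField E] [Algebra F E]
  [Algebra.IsQuadraticExtension F E] (c : E ≃ₐ[F] E)
  {δ : E} (hcδ : c δ = -δ) (hδ : δ ≠ 0) {d : F} (hd : δ * δ = algebraMap F E d)
  (v : HeightOneSpectrum (𝓞 F))
  [MeasurableSpace (v.adicCompletion F)] [BorelSpace (v.adicCompletion F)]
  (μ : Measure (v.adicCompletion F)) [μ.IsAddHaarMeasure]
  (n : ℕ) {T₀ : Matrix (Fin n) (Fin n) F} (hT₀ : T₀.IsSymm) (hT₀d : IsUnit T₀.det)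
  {J : Matrix (Fin n) (Fin n) E} (hJ : J = T₀.map (algebraMap F E))
  {JD : Matrix (Fin (n + n)) (Fin (n + n)) E} (hJD : JD = (gramD F n T₀).map (algebraMap F E))

/-! ## §1 The package's splitting is the `w`-datum's splitting, for every `w ∣ v` split -/

/-- **the `χ`-package at a split `v` IS the split datum at ANY `w ∣ v` with `c • w ≠ w`** (as far as the local
splitting goes): the package is the `w₀`-datum for the chosen `w₀ = h.choose` (definition), and Kudla's split-place
splitting does not depend on the choice (`localSplitting_localSplittingDatumSplit_eq`).
[cite: Kudla1994, Thm 3.1; HarrisKudlaSweet1996, §1 (1.15)–(1.16)] -/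
theorem localSplitting_localSplittingDatumQuadExt_eq (χ : HeckeCharacter E) (hχ : IsSplittingCharExt F E 1 χ)
    (hn : 0 < n) (t : Fin n → F) (hT₀t : T₀ = Matrix.diagonal t) (w : PlacesOver E v) (hw : c • w.1 ≠ w.1) :
    (localSplittingDatumQuadExt F E c hcδ hδ hd v μ n hT₀ hT₀d hJD χ hχ).localSplitting =
      (localSplittingDatumSplit F E c hcδ hδ hd v μ n hT₀ hT₀d hJD w hw
        (fun w' : PlacesOver E v => (χ.localComponent w'.1)⁻¹) (isTrivialNearOne_localComponent_inv F E v χ w)).localSplitting := by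
  classical
  have hex : ∃ w : PlacesOver E v, c • w.1 ≠ w.1 := ⟨w, hw⟩
  have hdef : localSplittingDatumQuadExt F E c hcδ hδ hd v μ n hT₀ hT₀d hJD χ hχ =
      localSplittingDatumSplit F E c hcδ hδ hd v μ n hT₀ hT₀d hJD hex.choose hex.choose_spec
        (fun w' : PlacesOver E v => (χ.localComponent w'.1)⁻¹)
        (isTrivialNearOne_localComponent_inv F E v χ hex.choose) := by
    unfold localSplittingDatumQuadExt
    rw [dif_pos hex]
  rw [hdef]
  exact localSplitting_localSplittingDatumSplit_eq F E c hcδ hδ hd v μ n hT₀ hT₀d hJD hex.choose w hex.choose_spec hw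
    _ (isSplitPair_localComponent_inv F E c hcδ hδ hd v χ hχ hex.choose hex.choose_spec)
    (isSplitPair_localComponent_inv F E c hcδ hδ hd v χ hχ w hw) _ _ hn t hT₀t

omit [MeasurableSpace (v.adicCompletion F)] [BorelSpace (v.adicCompletion F)] in
/-- congruence of `undoubleLoc` in the splitting (the proof of `π ∘ s = ι^𝔻` is irrelevant).
[cite: GelbartRogawski1991, §3.1 Prop. 3.1.1 p. 455] -/
theorem undoubleLoc_congr {s₁ s₂ : UnitaryGroup.localPi E c (n + n) JD v →* LocalMp F (n + n) (gramD F n T₀) v}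
    (h : s₁ = s₂)
    (h₁ : ∀ g, MpPsi.proj _ (s₁ g) = iota F E c (n + n) hcδ hδ hd (gramD F n T₀) (gramD_isSymm F n hT₀) hJD v g)
    (h₂ : ∀ g, MpPsi.proj _ (s₂ g) = iota F E c (n + n) hcδ hδ hd (gramD F n T₀) (gramD_isSymm F n hT₀) hJD v g) :
    undoubleLoc F E c v n hJ hJD hcδ hδ hd hT₀ hT₀d s₁ h₁ = undoubleLoc F E c v n hJ hJD hcδ hδ hd hT₀ hT₀d s₂ h₂ := by
  subst h
  rfl

/-! ## §2 The undoubled package at `w`: the mixed model with character `χ_w ∘ det` -/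

/-- **THE UNDOUBLED `χ`-PACKAGE AT A SPLIT PLACE, READ AT ANY `w ∣ v`, IS THE MIXED MODEL WITH CHARACTER
`χ_w ∘ det ∘ pr_w`.** For `s_v := undoubleLoc (localSplittingDatumQuadExt … χ hχ).localSplitting` and every Haar
measure `μ'` there is an `L²(μ'ⁿ)`-isometric `Γ` with, for all `a ∈ GL_n(F_v)` and `Φ`,
`ω_{s_v}(κ_a) Φ = χ_w(det ι_w(a)) • Γ⁻¹ (leviOpPi (x ↦ a⁻ᵀ x) (Γ Φ))` (`κ_a` of `w`-component `ι_w(a)`; `T₀` diagonal,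
`0 < n`). [cite: Kudla1994, Thm 3.1; HarrisKudlaSweet1996, §1 (1.15)–(1.16); MoeglinVignerasWaldspurger1987, Chap. 3 III.1] -/
theorem exists_mixedModel_undoubleLoc_localSplittingDatumQuadExt (χ : HeckeCharacter E)
    (hχ : IsSplittingCharExt F E 1 χ) (hn : 0 < n) (t : Fin n → F) (hT₀t : T₀ = Matrix.diagonal t)
    (w : PlacesOver E v) (hw : c • w.1 ≠ w.1) (hc : c ≠ 1) (hJc : (J.map c)ᵀ = J) (hJDc : (JD.map c)ᵀ = JD)
    (hJw : IsUnit (placeForm J w.1)) (hJDw : IsUnit (placeForm JD w.1))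
    (μ' : Measure (v.adicCompletion F)) [μ'.IsAddHaarMeasure] :
    ∃ Γ : (SchwartzBruhat (Fin n → v.adicCompletion F)) ≃ₗ[ℂ] (SchwartzBruhat (Fin n → v.adicCompletion F)),
      (∀ Φ : (SchwartzBruhat (Fin n → v.adicCompletion F)),
          SchwartzBruhat.l2NormSq (Measure.pi fun _ : Fin n => μ') (Γ Φ) =
          SchwartzBruhat.l2NormSq (Measure.pi fun _ : Fin n => μ') Φ) ∧
      ∀ (a : GL (Fin n) (v.adicCompletion F)) (Φ : (SchwartzBruhat (Fin n → v.adicCompletion F))),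
        (MpPsi.toRep (localSchrodinger F n T₀ v)).comp
            (undoubleLoc F E c v n hJ hJD hcδ hδ hd hT₀ hT₀d
              (localSplittingDatumQuadExt F E c hcδ hδ hd v μ n hT₀ hT₀d hJD χ hχ).localSplitting
              (localSplittingDatumQuadExt F E c hcδ hδ hd v μ n hT₀ hT₀d hJD χ hχ).proj_localSplitting)
            ((localPiSplitEquiv c J hc hJc w hw hJw).symm (Matrix.GeneralLinearGroup.map (toPlace v w) a)) Φ =
          ((χ.localComponent w.1 (Matrix.GeneralLinearGroup.det (Matrix.GeneralLinearGroup.map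
              (toPlace v w : v.adicCompletion F →+* w.1.adicCompletion E) a)) : ℂˣ) : ℂ) •
            Γ.symm (leviOpPi (glEquiv (GLn.contragredient a)) (Γ Φ)) := by
  obtain ⟨Γ, hΓi, h⟩ := exists_mixedModel_undoubleLoc_localSplittingDatumSplit F E c hcδ hδ hd v μ n hT₀ hT₀d hJ
    hJD w hw (fun w' : PlacesOver E v => (χ.localComponent w'.1)⁻¹)
    (isSplitPair_localComponent_inv F E c hcδ hδ hd v χ hχ w hw) (isTrivialNearOne_localComponent_inv F E v χ w)
    hn t hT₀t hc hJc hJDc hJw hJDw μ'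
  refine ⟨Γ, hΓi, fun a Φ => ?_⟩
  rw [undoubleLoc_congr F E c hcδ hδ hd v n hT₀ hT₀d hJ hJD
    (localSplitting_localSplittingDatumQuadExt_eq F E c hcδ hδ hd v μ n hT₀ hT₀d hJD χ hχ hn t hT₀t w hw)
    (localSplittingDatumQuadExt F E c hcδ hδ hd v μ n hT₀ hT₀d hJD χ hχ).proj_localSplitting
    (localSplittingDatumSplit F E c hcδ hδ hd v μ n hT₀ hT₀d hJD w hw
      (fun w' : PlacesOver E v => (χ.localComponent w'.1)⁻¹)
      (isTrivialNearOne_localComponent_inv F E v χ w)).proj_localSplitting,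
    h a Φ, MonoidHom.inv_apply, inv_inv]

omit [MeasurableSpace (v.adicCompletion F)] [BorelSpace (v.adicCompletion F)] in
/-- **the `(η, νK)` of the package at `w`, with NO inverse**: `η := χ_w ∘ det ∘ pr_w` satisfies the input `hη` of
the tree's `splitPlace_chiCoinv_iso_parabolicIndGL_explicit` with `νK := χ_w ∘ ι_w` (`det ι_w(a) = ι_w(det a)`), and
`ν := χ_w` satisfies `hν` by `rfl`. [cite: HarrisKudlaSweet1996, §1 (1.16); Kudla1994, Thm 3.1] -/
theorem chi_det_symm_map (hc : c ≠ 1) (hJc : (J.map c)ᵀ = J) (w : PlacesOver E v) (hw : c • w.1 ≠ w.1)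
    (hJw : IsUnit (placeForm J w.1)) (χw : (w.1.adicCompletion E)ˣ →* ℂˣ) (a : GL (Fin n) (v.adicCompletion F)) :
    (χw.comp (Matrix.GeneralLinearGroup.det.comp (localPiSplitEquiv c J hc hJc w hw hJw).toMulEquiv.toMonoidHom))
        ((localPiSplitEquiv c J hc hJc w hw hJw).symm (Matrix.GeneralLinearGroup.map (toPlace v w) a)) =
      (χw.comp (Units.map (toPlace v w : v.adicCompletion F →+* w.1.adicCompletion E).toMonoidHom))
        (Matrix.GeneralLinearGroup.det a) := by
  have h := inv_chi_det_symm_map F E c v n hc hJc w hw hJw χw a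
  rw [MonoidHom.inv_apply, MonoidHom.inv_apply, _root_.inv_inj] at h
  exact h

/-- **the package's `(Γ, η, hmodel)` triple VERBATIM** for `splitPlace_chiCoinv_iso_parabolicIndGL_explicit`, at ANY
`w ∣ v` split, with `η := χ_w ∘ det ∘ pr_w`.
[cite: Kudla1994, Thm 3.1; HarrisKudlaSweet1996, §1 (1.15)–(1.16); MoeglinVignerasWaldspurger1987, Chap. 3 III.1] -/
theorem exists_mixedModel_undoubleLoc_localSplittingDatumQuadExt' (χ : HeckeCharacter E)
    (hχ : IsSplittingCharExt F E 1 χ) (hn : 0 < n) (t : Fin n → F) (hT₀t : T₀ = Matrix.diagonal t)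
    (w : PlacesOver E v) (hw : c • w.1 ≠ w.1) (hc : c ≠ 1) (hJc : (J.map c)ᵀ = J) (hJDc : (JD.map c)ᵀ = JD)
    (hJw : IsUnit (placeForm J w.1)) (hJDw : IsUnit (placeForm JD w.1))
    (μ' : Measure (v.adicCompletion F)) [μ'.IsAddHaarMeasure] :
    ∃ Γ : (SchwartzBruhat (Fin n → v.adicCompletion F)) ≃ₗ[ℂ] (SchwartzBruhat (Fin n → v.adicCompletion F)),
      (∀ Φ : (SchwartzBruhat (Fin n → v.adicCompletion F)),
          SchwartzBruhat.l2NormSq (Measure.pi fun _ : Fin n => μ') (Γ Φ) =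
          SchwartzBruhat.l2NormSq (Measure.pi fun _ : Fin n => μ') Φ) ∧
      ∀ (a : GL (Fin n) (v.adicCompletion F)) (Φ : (SchwartzBruhat (Fin n → v.adicCompletion F))),
        (MpPsi.toRep (localSchrodinger F n T₀ v)).comp
            (undoubleLoc F E c v n hJ hJD hcδ hδ hd hT₀ hT₀d
              (localSplittingDatumQuadExt F E c hcδ hδ hd v μ n hT₀ hT₀d hJD χ hχ).localSplitting
              (localSplittingDatumQuadExt F E c hcδ hδ hd v μ n hT₀ hT₀d hJD χ hχ).proj_localSplitting)
            ((localPiSplitEquiv c J hc hJc w hw hJw).symm (Matrix.GeneralLinearGroup.map (toPlace v w) a)) Φ =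
          ((((χ.localComponent w.1).comp (Matrix.GeneralLinearGroup.det.comp
              (localPiSplitEquiv c J hc hJc w hw hJw).toMulEquiv.toMonoidHom))
              ((localPiSplitEquiv c J hc hJc w hw hJw).symm (Matrix.GeneralLinearGroup.map (toPlace v w) a)) : ℂˣ) :
              ℂ) • Γ.symm (leviOpPi (glEquiv (GLn.contragredient a)) (Γ Φ)) := by
  obtain ⟨Γ, hΓi, h⟩ := exists_mixedModel_undoubleLoc_localSplittingDatumQuadExt F E c hcδ hδ hd v μ n hT₀ hT₀d hJ
    hJD χ hχ hn t hT₀t w hw hc hJc hJDc hJw hJDw μ'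
  refine ⟨Γ, hΓi, fun a Φ => ?_⟩
  rw [h a Φ, chi_det_symm_map, MonoidHom.comp_apply, Matrix.GeneralLinearGroup.map_det]
  rfl

end Literature.NumberTheory.GelbartRogawski1991.UnitaryDualPair.LocalSplitting.QuadExt

end
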